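import Summits.HodgeConjecture.CorCM.IrreducibleOddWeightsCertificateMultiplicity
import HarnessLib

/-!
# Wedderburn certificates IV: products of CM abelian varieties — the Galois-model formula, the inflation to `Aut(ℂ)`
# and the Helly number, all from an odd certificate of `Gal(L/ℚ)`

COR-CM (cell `pub-hodgecm2`, binder seat `b16` gen 58, count-neutral claim CERTIFICATES (+ HELLY NUMBER), file F5 — CM
fields; theorems only, no definition, no named fact, no `sorry`).  NEW as stated, hence under `Summits/`.  HONEST FRAMING:
«rank / nondegeneracy / Hodge conjecture with `B• = D•` for NAMED configurations of CM abelian varieties» made CHECKABLE: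
every representation-theoretic hypothesis of the gen-57 census recipe is replaced by a finite certificate; unconditional;
`HC_CM` is neither used nor asserted.

SETTING.  CM fields `K_i ⊆ L` (Galois CM; `e_i : K_i → L`, `ι : L → ℂ`), `G₀ = Gal(L/ℚ)`, `ρ` the complex conjugation
(`ι ∘ ρ = conj ∘ ι`), types `Φ_i` read on `G₀` as `Ψ_i = {g | ι ∘ g ∘ e_i ∈ Φ_i}`, `u_i = 𝟙_{Ψ_i} − 𝟙_{ρΨ_i}`.  ODD CERTIFICATE
of `G₀`: non-zero `Z_k`-linear `ℚ`-representations `π_k` (`Z_k` division rings, `r_k = dim_{Z_k} V_k`, `d_k = dim_ℚ V_k`) with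
`π_k(ρ) = −1`, `2 Σ_k r_k d_k ≤ |G₀|`, and `Σ_g c(g)π_k(g) = 0 ∀k ⟹ c = 0` for every ODD `c : G₀ → ℚ`.

* §1 **`cmFamilyRank_eq_one_add_sum_of_oddCertificate`** (`dim MT(∏_i A_i) = 1 + Σ_k r_k · dim_ℚ Σ_i range π_k(u_i)`),
  `isNondegenerateFamily_iff_sum_eq_of_oddCertificate` (one CM type and Mai's criterion literally: file F7
  `…CertificateCMTypes`).
* §2 THE INFLATION (gen-57 «What remains» #1): **`exists_cover_aut_of_oddCertificate`** — covering data for `Aut(ℂ)` on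
  the slots `Hom(K_i, ℂ)` (the hypotheses of the gen-57 CM criteria): `Aut(ℂ) → G₀` is onto and a stable
  `P ≤ ℚ^{Hom(K_i, ℂ)}` pulls back along `g ↦ ι ∘ g ∘ e_i` to a stable odd subspace of `ℚ^{G₀}`.
* §3 THE HELLY NUMBER FOR CM ABELIAN VARIETIES: **`isNondegenerateFamily_iff_forall_card_le_of_oddCertificate`** (`r_k ≤ q`:
  `Hg(∏_{i∈I} A_i) = ∏ Hg(A_i)` of maximal rank IFF so on every sub-collection of `≤ q + 1` factors) and
  **`hodgeConjectureFor_prod_of_forall_card_le_of_oddCertificate`** (then HC with `B• = D•` on every `∏ A_i^{k_i}`).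

## References

* [Mai1989] L. Mai, *Lower bounds for the ranks of CM types*, J. Number Theory 32 (1989), §2 Prop. 1.
* [Kubota1965] T. Kubota, *On the field extension by complex multiplication*, Trans. AMS 118 (1965), §4 Lemma 2.
* [Shimura1998] G. Shimura, *Abelian Varieties with Complex Multiplication and Modular Functions*, §8.1, §18.2.
* [Gordon1999HodgeAVSurvey] B. B. Gordon, *A survey of the Hodge conjecture for abelian varieties*, 7.5–7.7, 10.10.
* [Serre1977] J.-P. Serre, *Linear Representations of Finite Groups*, GTM 42 (1977), §6.5 Prop. 16, §12.2.
-/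

set_option autoImplicit false

noncomputable section

open scoped BigOperators

open CategoryTheory CategoryTheory.Limits NumberField

universe u'

namespace Summit.HodgeConjecture.CorCM

open Literature.NumberTheory.ComplexMultiplication
open Literature.AlgebraicGeometry.Motives (AbelianVariety CMType)
open Literature.AlgebraicGeometry.HodgeTheory
open Literature.AlgebraicGeometry.ComplexMultiplication (IsCMTypeRealisation)
open Literature.AlgebraicGeometry.Pohlmann1968
open Literature.AlgebraicGeometry.VanGeemen1994 (hodgeClassSpan)
open Literature.Barriers.HodgeConjecture (divisorClassesSpan)

variable {I : Type} [Fintype I] {K : I → Type} [∀ i, Field (K i)] [∀ i, NumberField (K i)] [∀ i, IsCMField (K i)]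
  {L : Type} [Field L] [NumberField L] [IsCMField L] [Normal ℚ L]
  {κ : Type u'} [Fintype κ] {V : κ → Type*} [∀ k, AddCommGroup (V k)] [∀ k, Module ℚ (V k)]
  [∀ k, FiniteDimensional ℚ (V k)]
  {Z : κ → Type*} [∀ k, DivisionRing (Z k)] [∀ k, Module (Z k) (V k)] [∀ k, Module.Finite (Z k) (V k)]

/-! ### §0 Complex conjugation and the restriction `Aut(ℂ) → Gal(L/ℚ)` -/

omit [IsCMField L] [Normal ℚ L] in
/-- `ρ² = 1` for the complex conjugation `ρ` of `L` read through `ι`. [cite: Shimura1998, §18.2 Lemma (i)] -/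
theorem conj_mul_conj_eq_one (ι : L →+* ℂ) (ρ : L ≃ₐ[ℚ] L) (hρ : ∀ x, ι (ρ x) = starRingEnd ℂ (ι x)) : ρ * ρ = 1 :=
  AlgEquiv.ext fun x => ι.injective (by rw [AlgEquiv.mul_apply, hρ, hρ, starRingEnd_self_apply, AlgEquiv.one_apply])

omit [IsCMField L] in
/-- **The restriction homomorphism `r : Aut(ℂ) → Gal(L/ℚ)`** (`τ ∘ ι = ι ∘ r(τ)`), onto. [cite: Shimura1998, §8.1] -/
theorem exists_restrictHom (ι : L →+* ℂ) :
    ∃ r : (ℂ ≃+* ℂ) →* (L ≃ₐ[ℚ] L), (∀ (τ : ℂ ≃+* ℂ) (y : L), τ (ι y) = ι (r τ y)) ∧ Function.Surjective r := by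
  choose r hr using fun τ : ℂ ≃+* ℂ => exists_algEquiv_comp_eq_smul ι τ
  have hmul : ∀ τ τ' : ℂ ≃+* ℂ, r (τ * τ') = r τ * r τ' := fun τ τ' =>
    AlgEquiv.ext fun y => ι.injective (by
      rw [← hr]
      change τ (τ' (ι y)) = _
      rw [hr τ', hr τ, AlgEquiv.mul_apply])
  refine ⟨MonoidHom.mk' r hmul, fun τ y => hr τ y, fun γ => ?_⟩
  obtain ⟨τ, hτ⟩ := exists_ringEquiv_comp_eq_algEquiv ι γ
  exact ⟨τ, AlgEquiv.ext fun y => ι.injective (by rw [MonoidHom.mk'_apply, ← hr τ y, hτ y])⟩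

/-! ### §1 The Galois-model formula from an odd certificate -/

omit [∀ i, IsCMField (K i)] in
/-- **`dim MT(∏_i A_i) = cmFamilyRank Φ = 1 + Σ_k r_k · dim_ℚ Σ_i range π_k(u_{Ψ_i})` FROM AN ODD CERTIFICATE OF
`Gal(L/ℚ)`** — the gen-57 census recipe with irreducibility, disjointness, completeness and the `δ_k` replaced by
`π_k(ρ) = −1`, `Z_k`-linearity, `2 Σ_k r_k d_k ≤ |Gal(L/ℚ)|`, and faithfulness of the odd functions.
[cite: Mai1989, §2 Prop. 1 (proof)] [cite: Kubota1965, §4 Lemma 2] [cite: Serre1977, §6.5 Prop. 16 and §12.2] -/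
theorem cmFamilyRank_eq_one_add_sum_of_oddCertificate [Nonempty I] (ι : L →+* ℂ) (e : ∀ i, K i →+* L)
    (ρ : L ≃ₐ[ℚ] L) (hρ : ∀ x, ι (ρ x) = starRingEnd ℂ (ι x)) (Φ : ∀ i, CMType (K i))
    (π : ∀ k, Representation ℚ (L ≃ₐ[ℚ] L) (V k)) [∀ k, Nontrivial (V k)]
    (hlin : ∀ k (g : L ≃ₐ[ℚ] L) (z : Z k) (v : V k), π k g (z • v) = z • π k g v) (hodd : ∀ k (v : V k), π k ρ v = -v)
    (hcount : 2 * ∑ k, Module.finrank (Z k) (V k) * Module.finrank ℚ (V k) ≤ Fintype.card (L ≃ₐ[ℚ] L))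
    (hfaith : ∀ c : (L ≃ₐ[ℚ] L) → ℚ, (∀ g, c (ρ * g) = -c g) → (∀ k, ∑ g, c g • π k g = 0) → c = 0) :
    CMAlgebra.cmFamilyRank Φ = 1 + ∑ k, Module.finrank (Z k) (V k) *
      Module.finrank ℚ (⨆ i, LinearMap.range (∑ g : L ≃ₐ[ℚ] L,
          antiVec ({g : L ≃ₐ[ℚ] L | (ι.comp (g : L →+* L)).comp (e i) ∈ (Φ i).1} : Set (L ≃ₐ[ℚ] L))
            (1 : L ≃ₐ[ℚ] L) g • π k g) : Submodule ℚ (V k)) := by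
  classical
  obtain ⟨i₀⟩ := ‹Nonempty I›
  haveI : Nonempty (Σ _ : I, (L ≃ₐ[ℚ] L)) := ⟨⟨i₀, 1⟩⟩
  have hΨ := isCMTypeWith_gal_family ι e ρ hρ Φ
  have hcount' : ∑ k, Module.finrank (Z k) (V k) * Module.finrank ℚ (V k) ≤
      Module.finrank ℚ (antiWeights (E := L ≃ₐ[ℚ] L) ρ) := by
    have := IrrOdd.card_le_two_mul_finrank_antiWeights (hΨ i₀)
    omega
  have hformula := IrrOdd.finrank_antiSpan_sigmaType_eq_sum_finrank_range_of_oddCertificate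
    (fun i => ({g : L ≃ₐ[ℚ] L | (ι.comp (g : L →+* L)).comp (e i) ∈ (Φ i).1} : Set (L ≃ₐ[ℚ] L))) hΨ π hlin
    (conj_mul_conj_eq_one ι ρ hρ) hodd hcount' hfaith
  rw [cmFamilyRank_eq_typeRank_gal ι e Φ, (IsCMTypeWith.sigmaType hΨ).typeRank_eq_finrank_antiSpan_add_one, hformula,
    add_comm]

omit [∀ i, IsCMField (K i)] in
/-- **The family is nondegenerate (`Hg(∏_i A_i) = ∏_i Hg(A_i)` of maximal rank) iff
`Σ_k r_k · dim_ℚ Σ_i range π_k(u_{Ψ_i}) = Σ_i [K_i:ℚ]/2`** (odd certificate of `Gal(L/ℚ)`); then `B• = D•` and HC hold on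
every product of the `A_i` (`IsNondegenerateFamily.hodgeConjectureFor_prod`). [cite: Mai1989, §2 Prop. 1] [cite: Gordon1999HodgeAVSurvey, 7.5] -/
theorem isNondegenerateFamily_iff_sum_eq_of_oddCertificate [Nonempty I] (ι : L →+* ℂ) (e : ∀ i, K i →+* L)
    (ρ : L ≃ₐ[ℚ] L) (hρ : ∀ x, ι (ρ x) = starRingEnd ℂ (ι x)) (Φ : ∀ i, CMType (K i))
    (π : ∀ k, Representation ℚ (L ≃ₐ[ℚ] L) (V k)) [∀ k, Nontrivial (V k)]
    (hlin : ∀ k (g : L ≃ₐ[ℚ] L) (z : Z k) (v : V k), π k g (z • v) = z • π k g v) (hodd : ∀ k (v : V k), π k ρ v = -v)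
    (hcount : 2 * ∑ k, Module.finrank (Z k) (V k) * Module.finrank ℚ (V k) ≤ Fintype.card (L ≃ₐ[ℚ] L))
    (hfaith : ∀ c : (L ≃ₐ[ℚ] L) → ℚ, (∀ g, c (ρ * g) = -c g) → (∀ k, ∑ g, c g • π k g = 0) → c = 0) :
    CMAlgebra.IsNondegenerateFamily Φ ↔ ∑ k, Module.finrank (Z k) (V k) *
      Module.finrank ℚ (⨆ i, LinearMap.range (∑ g : L ≃ₐ[ℚ] L,
          antiVec ({g : L ≃ₐ[ℚ] L | (ι.comp (g : L →+* L)).comp (e i) ∈ (Φ i).1} : Set (L ≃ₐ[ℚ] L))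
            (1 : L ≃ₐ[ℚ] L) g • π k g) : Submodule ℚ (V k)) = (∑ i, Module.finrank ℚ (K i)) / 2 := by
  rw [CMAlgebra.isNondegenerateFamily_iff, cmFamilyRank_eq_one_add_sum_of_oddCertificate ι e ρ hρ Φ π hlin hodd hcount
    hfaith]
  omega

/-! ### §2 The inflation: covering data for `Aut(ℂ)` on `Hom(K_i, ℂ)` from an odd certificate of `Gal(L/ℚ)` -/

omit [Fintype I] in
/-- **INFLATION.**  From an odd certificate of `G₀ = Gal(L/ℚ)`: the inflated representations `π̃_k = π_k ∘ r` of `Aut(ℂ)`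
(`r` the restriction through `ι`, onto) are irreducible, pairwise disjoint, cover every non-zero `Aut(ℂ)`-stable
`P ≤ U(Φ_i) ≤ ℚ^{Hom(K_i,ℂ)}` (pull `P` back along `g ↦ ι ∘ g ∘ e_i` to a stable ODD subspace of `ℚ^{G₀}`, covered by F2),
and `d_k ≤ r_k · dim End_{Aut(ℂ)} V_k`. [cite: Shimura1998, §8.1] [cite: Serre1977, §6.5 Prop. 16 and §12.2] -/
theorem exists_cover_aut_of_oddCertificate [Nonempty I] (ι : L →+* ℂ) (e : ∀ i, K i →+* L) (ρ : L ≃ₐ[ℚ] L)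
    (hρ : ∀ x, ι (ρ x) = starRingEnd ℂ (ι x)) (Φ : ∀ i, CMType (K i))
    (π : ∀ k, Representation ℚ (L ≃ₐ[ℚ] L) (V k)) [∀ k, Nontrivial (V k)]
    (hlin : ∀ k (g : L ≃ₐ[ℚ] L) (z : Z k) (v : V k), π k g (z • v) = z • π k g v) (hodd : ∀ k (v : V k), π k ρ v = -v)
    (hcount : 2 * ∑ k, Module.finrank (Z k) (V k) * Module.finrank ℚ (V k) ≤ Fintype.card (L ≃ₐ[ℚ] L))
    (hfaith : ∀ c : (L ≃ₐ[ℚ] L) → ℚ, (∀ g, c (ρ * g) = -c g) → (∀ k, ∑ g, c g • π k g = 0) → c = 0) :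
    ∃ πC : ∀ k, Representation ℚ (ℂ ≃+* ℂ) (V k),
      (∀ k, (πC k).IsIrreducible) ∧
      (∀ k l, k ≠ l → ∀ S : (πC k).IntertwiningMap (πC l), S = 0) ∧
      (∀ (i : I) (P : Submodule ℚ ((K i →+* ℂ) → ℚ)), P ≤ antiSpan (ℂ ≃+* ℂ) (Φ i).1 → P ≠ ⊥ →
        (∀ (τ : ℂ ≃+* ℂ) (a : (K i →+* ℂ) → ℚ), a ∈ P → (fun s => a (τ • s)) ∈ P) →
        ∃ k, ∃ T : ((K i →+* ℂ) → ℚ) →ₗ[ℚ] V k,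
          (∀ (τ : ℂ ≃+* ℂ) (a : (K i →+* ℂ) → ℚ), T (fun s => a (τ⁻¹ • s)) = πC k τ (T a)) ∧ ∃ a ∈ P, T a ≠ 0) ∧
      (∀ k, Module.finrank ℚ (V k) ≤
        Module.finrank (Z k) (V k) * Module.finrank ℚ ((πC k).IntertwiningMap (πC k))) ∧
      (∀ k (τ : ℂ ≃+* ℂ) (z : Z k) (v : V k), πC k τ (z • v) = z • πC k τ v) := by
  classical
  obtain ⟨r, hr, hsurj⟩ := exists_restrictHom ι
  have hρ2 : ρ * ρ = 1 := conj_mul_conj_eq_one ι ρ hρ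
  have hrconj : r (starRingAut : ℂ ≃+* ℂ) = ρ :=
    AlgEquiv.ext fun y => ι.injective (by rw [← hr, hρ]; rfl)
  -- the certificate on `G₀`
  obtain ⟨i₀⟩ := ‹Nonempty I›
  have hcount' : ∑ k, Module.finrank (Z k) (V k) * Module.finrank ℚ (V k) ≤
      Module.finrank ℚ (antiWeights (E := L ≃ₐ[ℚ] L) ρ) := by
    have hΨ := isCMTypeWith_gal_family ι e ρ hρ Φ
    have := IrrOdd.card_le_two_mul_finrank_antiWeights (hΨ i₀)
    omega
  have hfaith' : ∀ c ∈ antiWeights (E := L ≃ₐ[ℚ] L) ρ, (∀ k, ∑ g, c g • π k g = 0) → c = 0 := fun c hc h0 =>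
    hfaith c (mem_antiWeights_iff'.1 hc) h0
  have hirr := fun k => IrrOdd.isIrreducible_of_certificate π hlin _ hcount' hfaith' k
  have hne := fun k l (hkl : k ≠ l) (S : (π k).IntertwiningMap (π l)) =>
    IrrOdd.intertwiningMap_eq_zero_of_certificate π hlin _ hcount' hfaith' hkl S
  -- the inflated representations
  let πC : ∀ k, Representation ℚ (ℂ ≃+* ℂ) (V k) := fun k => (π k).comp r
  have hπC : ∀ k (τ : ℂ ≃+* ℂ), πC k τ = π k (r τ) := fun k τ => rfl
  refine ⟨πC, fun k => ?_, fun k l hkl S => ?_, fun i P hPU hP0 hPst => ?_, fun k => ?_, fun k τ z v => ?_⟩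
  · -- irreducible: a `πC`-stable subspace is `π`-stable since `r` is onto
    haveI := hirr k
    haveI : Nontrivial (Subrepresentation (πC k)) := ⟨⊥, ⊤, fun h => by
      have h' := congrArg Subrepresentation.toSubmodule h
      change (⊥ : Submodule ℚ (V k)) = ⊤ at h'
      exact bot_ne_top h'⟩
    refine ⟨fun W => ?_⟩
    let W' : Subrepresentation (π k) := ⟨W.toSubmodule, fun γ v hv => by
      obtain ⟨τ, rfl⟩ := hsurj γ
      exact W.apply_mem_toSubmodule τ hv⟩
    rcases (hirr k).eq_bot_or_eq_top W' with hW | hW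
    · left
      apply Subrepresentation.toSubmodule_injective
      have h' : W'.toSubmodule = (⊥ : Subrepresentation (π k)).toSubmodule := congrArg Subrepresentation.toSubmodule hW
      exact h'
    · right
      apply Subrepresentation.toSubmodule_injective
      have h' : W'.toSubmodule = (⊤ : Subrepresentation (π k)).toSubmodule := congrArg Subrepresentation.toSubmodule hW
      exact h'
  · -- no intertwiners
    let S' : (π k).IntertwiningMap (π l) := ⟨S.toLinearMap, fun γ => by
      obtain ⟨τ, rfl⟩ := hsurj γ
      exact S.isIntertwining' τ⟩
    have hS' := hne k l hkl S'
    apply Representation.IntertwiningMap.ext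
    have := congrArg Representation.IntertwiningMap.toLinearMap hS'
    exact this
  · -- covering: pull `P` back to `ℚ^{G₀}` along `g ↦ ι ∘ g ∘ e_i`
    let p : (L ≃ₐ[ℚ] L) → (K i →+* ℂ) := fun g => (ι.comp (g : L →+* L)).comp (e i)
    have hp : ∀ (τ : ℂ ≃+* ℂ) (g : L ≃ₐ[ℚ] L), τ • p g = p (r τ * g) := fun τ g => by
      refine RingHom.ext fun x => ?_
      change τ (ι (g (e i x))) = ι ((r τ * g) (e i x))
      rw [hr, AlgEquiv.mul_apply]
    have hpsurj : Function.Surjective p := fun s => by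
      obtain ⟨g, hg⟩ := exists_eq_comp_algEquiv_comp ι e i s
      exact ⟨g, hg.symm⟩
    let F : ((K i →+* ℂ) → ℚ) →ₗ[ℚ] ((L ≃ₐ[ℚ] L) → ℚ) := LinearMap.funLeft ℚ ℚ p
    have hF : ∀ (a : (K i →+* ℂ) → ℚ) (g : L ≃ₐ[ℚ] L), F a g = a (p g) := fun a g => rfl
    have hFinj : Function.Injective F := LinearMap.funLeft_injective_of_surjective ℚ ℚ p hpsurj
    -- the pulled-back subspace: non-zero, stable, odd
    have hQ0 : P.map F ≠ ⊥ := by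
      obtain ⟨a, haP, ha0⟩ := Submodule.exists_mem_ne_zero_of_ne_bot hP0
      intro h
      exact ha0 (hFinj (by rw [map_zero]; exact (Submodule.mem_bot ℚ).1 (h ▸ Submodule.mem_map_of_mem haP)))
    have hQst : ∀ (γ : L ≃ₐ[ℚ] L) (q : (L ≃ₐ[ℚ] L) → ℚ), q ∈ P.map F → (fun x => q (γ • x)) ∈ P.map F := by
      intro γ q hq
      obtain ⟨a, haP, rfl⟩ := hq
      obtain ⟨τ, rfl⟩ := hsurj γ
      refine ⟨fun s => a (τ • s), hPst τ a haP, ?_⟩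
      funext x
      rw [hF, hF, smul_eq_mul, hp]
    have hQodd : P.map F ≤ antiWeights (E := L ≃ₐ[ℚ] L) ρ := by
      intro q hq
      obtain ⟨a, haP, rfl⟩ := hq
      rw [mem_antiWeights_iff']
      intro x
      have ha : a ∈ antiWeights (E := K i →+* ℂ) (starRingAut : ℂ ≃+* ℂ) :=
        antiSpan_le_antiWeights' (isCMTypeWith_conj (Φ i)) (hPU haP)
      rw [hF, hF, smul_eq_mul, ← hrconj, ← hp]
      exact mem_antiWeights_iff'.1 ha (p x)
    obtain ⟨k, T', hT', q₀, hq₀, hq₀0⟩ := IrrOdd.cover_perm_of_oddCertificate π hlin hρ2 hodd hcount' hfaith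
      (P.map F) hQ0 hQst hQodd
    obtain ⟨a₀, ha₀P, rfl⟩ := hq₀
    refine ⟨k, T' ∘ₗ F, fun τ a => ?_, a₀, ha₀P, hq₀0⟩
    have hpull : F (fun s => a (τ⁻¹ • s)) = fun x => F a ((r τ)⁻¹ • x) := by
      funext x
      rw [hF, hF, smul_eq_mul, hp, map_inv]
    rw [LinearMap.comp_apply, LinearMap.comp_apply, hpull, hT', hπC]
  · -- `d_k ≤ r_k · δ̃_k`: `End_{G₀} V_k ↪ End_{Aut(ℂ)} V_k` and `δ_k r_k = d_k`
    let J : (π k).IntertwiningMap (π k) →ₗ[ℚ] (πC k).IntertwiningMap (πC k) :=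
      { toFun := fun S => ⟨S.toLinearMap, fun τ => S.isIntertwining' (r τ)⟩
        map_add' := fun _ _ => rfl
        map_smul' := fun _ _ => rfl }
    have hJ : Function.Injective J := fun S S' h => by
      apply Representation.IntertwiningMap.ext
      have h' : (J S).toLinearMap = (J S').toLinearMap := congrArg Representation.IntertwiningMap.toLinearMap h
      exact h'
    have h1 := LinearMap.finrank_le_finrank_of_injective hJ
    have h2 := IrrOdd.finrank_intertwiningMap_mul_eq_of_certificate π hlin _ hcount' hfaith' k
    calc Module.finrank ℚ (V k)
        = Module.finrank (Z k) (V k) * Module.finrank ℚ ((π k).IntertwiningMap (π k)) := by rw [← h2, mul_comm]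
      _ ≤ Module.finrank (Z k) (V k) * Module.finrank ℚ ((πC k).IntertwiningMap (πC k)) :=
        Nat.mul_le_mul_left _ h1
  · rw [hπC, hlin]

/-! ### §3 The Helly number for products of CM abelian varieties -/

/-- **THE HELLY NUMBER FOR CM ABELIAN VARIETIES.**  Odd certificate of `Gal(L/ℚ)` with `r_k ≤ q` for all `k`: the
family `(Φ_i)` is nondegenerate (`Hg(∏_i A_i) = ∏_i Hg(A_i)` of maximal rank) IFF every non-empty sub-family of at most
`q + 1` members is. [cite: Mai1989, §2 Prop. 1 (proof)] [cite: Gordon1999HodgeAVSurvey, §3 and 7.5–7.7] -/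
theorem isNondegenerateFamily_iff_forall_card_le_of_oddCertificate [Nonempty I] (ι : L →+* ℂ) (e : ∀ i, K i →+* L)
    (ρ : L ≃ₐ[ℚ] L) (hρ : ∀ x, ι (ρ x) = starRingEnd ℂ (ι x)) (Φ : ∀ i, CMType (K i))
    (π : ∀ k, Representation ℚ (L ≃ₐ[ℚ] L) (V k)) [∀ k, Nontrivial (V k)]
    (hlin : ∀ k (g : L ≃ₐ[ℚ] L) (z : Z k) (v : V k), π k g (z • v) = z • π k g v) (hodd : ∀ k (v : V k), π k ρ v = -v)
    (hcount : 2 * ∑ k, Module.finrank (Z k) (V k) * Module.finrank ℚ (V k) ≤ Fintype.card (L ≃ₐ[ℚ] L))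
    (hfaith : ∀ c : (L ≃ₐ[ℚ] L) → ℚ, (∀ g, c (ρ * g) = -c g) → (∀ k, ∑ g, c g • π k g = 0) → c = 0)
    (q : ℕ) (hq : ∀ k, Module.finrank (Z k) (V k) ≤ q) :
    CMAlgebra.IsNondegenerateFamily Φ ↔
      ∀ T : Finset I, T.Nonempty → T.card ≤ q + 1 →
        CMAlgebra.IsNondegenerateFamily (K := fun j : (T : Set I) => K j) fun j => Φ j := by
  classical
  obtain ⟨πC, hirrC, hneC, hcovC, hqC, -⟩ :=
    exists_cover_aut_of_oddCertificate ι e ρ hρ Φ π hlin hodd hcount hfaith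
  obtain ⟨i₀⟩ := ‹Nonempty I›
  haveI : ∀ i, Nonempty (K i →+* ℂ) := fun i => inferInstance
  -- both sides through the ranks of the `Aut(ℂ)`-types
  have hcardI : Fintype.card (Σ i, (K i →+* ℂ)) = ∑ i, Module.finrank ℚ (K i) := by
    rw [Fintype.card_sigma]
    exact Finset.sum_congr rfl fun i _ => Embeddings.card (K i) ℂ
  have hcardT : ∀ T : Finset I, Fintype.card (Σ j : (T : Set I), (K j →+* ℂ)) =
      ∑ j : (T : Set I), Module.finrank ℚ (K j) := by
    intro T
    rw [Fintype.card_sigma]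
    exact Finset.sum_congr rfl fun j _ => Embeddings.card (K j) ℂ
  have hmain := IrrOdd.typeRank_sigmaType_eq_iff_forall_card_le (E := fun i => K i →+* ℂ)
    (fun i => isCMTypeWith_conj (Φ i)) πC hirrC hneC hcovC q fun k =>
      (hqC k).trans (Nat.mul_le_mul_right _ (hq k))
  rw [CMAlgebra.isNondegenerateFamily_iff, ← hcardI]
  change typeRank (ℂ ≃+* ℂ) (sigmaType fun i => (Φ i).1) = _ ↔ _
  rw [hmain]
  refine forall_congr' fun T => forall_congr' fun hT => forall_congr' fun _ => ?_
  rw [CMAlgebra.isNondegenerateFamily_iff, ← hcardT T]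
  rfl

variable {A : I → AbelianVariety ℂ} {ιA : ∀ i, 𝓞 (K i) →+* End (A i)}
  {θ : ∀ i, K i →+* Module.End ℂ (complexBetti (A i).X 1)}

/-- **HC ON ALL PRODUCTS FROM `(q+1)`-WISE NONDEGENERACY** (odd certificate of `Gal(L/ℚ)`, `r_k ≤ q`): if every
sub-family of `≤ q + 1` of the `Φ_i` is nondegenerate, then on every product `⨁_{j<N} A_{c j}` of realisations the Hodge
conjecture holds with `B• = D•`. [cite: Gordon1999HodgeAVSurvey, 7.5 and 10.10] [cite: Mai1989, §2 Prop. 1 (proof)] -/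
theorem hodgeConjectureFor_prod_of_forall_card_le_of_oddCertificate [Nonempty I] (ι : L →+* ℂ) (e : ∀ i, K i →+* L)
    (ρ : L ≃ₐ[ℚ] L) (hρ : ∀ x, ι (ρ x) = starRingEnd ℂ (ι x)) (Φ : ∀ i, CMType (K i))
    (π : ∀ k, Representation ℚ (L ≃ₐ[ℚ] L) (V k)) [∀ k, Nontrivial (V k)]
    (hlin : ∀ k (g : L ≃ₐ[ℚ] L) (z : Z k) (v : V k), π k g (z • v) = z • π k g v) (hodd : ∀ k (v : V k), π k ρ v = -v)
    (hcount : 2 * ∑ k, Module.finrank (Z k) (V k) * Module.finrank ℚ (V k) ≤ Fintype.card (L ≃ₐ[ℚ] L))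
    (hfaith : ∀ c : (L ≃ₐ[ℚ] L) → ℚ, (∀ g, c (ρ * g) = -c g) → (∀ k, ∑ g, c g • π k g = 0) → c = 0)
    (q : ℕ) (hq : ∀ k, Module.finrank (Z k) (V k) ≤ q)
    (hsub : ∀ T : Finset I, T.Nonempty → T.card ≤ q + 1 →
      CMAlgebra.IsNondegenerateFamily (K := fun j : (T : Set I) => K j) fun j => Φ j)
    (hA : ∀ i, IsCMTypeRealisation (Φ i) (A i) (ιA i) (θ i)) {N : ℕ} (c : Fin N → I) :
    HodgeConjectureFor (⨁ fun j : Fin N => A (c j)).dim (⨁ fun j : Fin N => A (c j)).X ∧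
      ∀ m : ℕ, hodgeClassSpan (⨁ fun j : Fin N => A (c j)).dim (⨁ fun j : Fin N => A (c j)).X m =
        divisorClassesSpan (⨁ fun j : Fin N => A (c j)).X (⨁ fun j : Fin N => A (c j)).dim m := by
  have hnd : CMAlgebra.IsNondegenerateFamily Φ :=
    (isNondegenerateFamily_iff_forall_card_le_of_oddCertificate ι e ρ hρ Φ π hlin hodd hcount hfaith q hq).2 hsub
  exact ⟨hnd.hodgeConjectureFor_prod hA c, fun m => hnd.hodgeClassSpan_prod_eq_divisorClassesSpan hA c m⟩

end Summit.HodgeConjecture.CorCM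

end
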